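import Literature.Analysis.SpecialFunctions.ZhouTripleEllipticIntegral
import HarnessLib

/-!
# Legendre's relation `EK′ + E′K − KK′ = π/2` for all moduli: proof (Lawden 1989, (3.8.29))

Topic `Literature/Analysis/SpecialFunctions`; proof companion of `ZhouTripleEllipticIntegral.lean`
(Part 2), which vendors Legendre's relation as the named fact `Lawden1989_eq_3_8_29` over the
algebraic forms `completeEllipticK k = ∫_{(0,1)} dt/√((1 − t²)(1 − k²t²))` and
`completeEllipticE k = ∫_{(0,1)} √(1 − k²t²)/√(1 − t²) dt`. Here that fact is DISCHARGED:
`Lawden1989_eq_3_8_29_holds : Lawden1989_eq_3_8_29`. Only theorems are added — no new named fact and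
no auxiliary function: every auxiliary integral is written out (the sibling
`ZhouTripleEllipticIntegralProofs.lean` is the Zhou Prop. 5.1 groundwork and is not touched).

## The printed proof (D. F. Lawden, *Elliptic Functions and Applications*, Springer 1989, §3.8,
## PDF pp. 99–100) and how it is followed

Lawden works with the trigonometric forms (3.8.1) `K = ∫₀^{π/2} (1 − k² sin²θ)^{-1/2} dθ` and
(3.8.3) `E = ∫₀^{π/2} (1 − k² sin²θ)^{1/2} dθ`; differentiating under the integral sign gives (3.8.7)
`dE/dk = −k ∫ sin²θ (1 − k² sin²θ)^{-1/2} dθ = (E − K)/k` and (3.8.8)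
`dK/dk = k ∫ sin²θ (1 − k² sin²θ)^{-3/2} dθ`, which the integrated identity (3.8.9)–(3.8.10)
`k′² ∫ sin²θ (1 − k² sin²θ)^{-3/2} = ∫ cos²θ (1 − k² sin²θ)^{-1/2}` and (3.8.11)
`E − k′²K = k² ∫ cos²θ (1 − k² sin²θ)^{-1/2}` turn into (3.8.12) `dK/dk = (E − k′²K)/(kk′²)`; with the
primed versions (3.8.14) one gets (3.8.24) `d/dk (EK′ + E′K − KK′) = 0`, and the constant is found
from the limit `k → 0` ((3.8.25)–(3.8.28): `E, K → π/2`, `E′ → 1`, `(E − K)K′ → 0`), giving (3.8.29).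

This file formalizes exactly this argument in the PARAMETER `m = k²` (so `k′² = 1 − m` and no square
root enters the chain rule):

* `completeEllipticK_eq_Kt`, `completeEllipticE_eq_Et` — the substitution `t = sin θ` from the
  algebraic forms to (3.8.1)/(3.8.3) (Mathlib's `integral_image_eq_integral_abs_deriv_smul`; no
  integrability hypothesis is needed);
* `hasDerivAt_Et`, `hasDerivAt_Kt` — (3.8.7), (3.8.8) as `m`-derivatives (`dE/dm = −½∫sin²θ(…)^{-1/2}`,
  `dK/dm = ½∫sin²θ(…)^{-3/2}`), by dominated differentiation under the integral sign
  (`1 − m sin²θ` is bounded below near every `m₀ < 1`);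
* `Gt_eq` — (3.8.9)–(3.8.10), by the fundamental theorem of calculus for
  `θ ↦ sin θ cos θ (1 − m sin²θ)^{-1/2}`; `Et_sub_Kt`, `Et_sub_mul_Kt`, `Ct_relation` — (3.8.7)
  (right-hand side), (3.8.11), (3.8.12);
* the abstract step (section `Abstract`, arbitrary functions `K E D C : ℝ → ℝ` satisfying the four
  relations): `hasDerivAt_legendre` — (3.8.24); `legendre_eq_legendre` — constancy on `(0,1)`;
  `tendsto_legendre` — (3.8.25)–(3.8.28); `legendre_eq` — (3.8.29) in parameter form.
  DEVIATION: Lawden bounds `(E − K)K′ → 0` through the nome asymptotics (3.8.26)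
  `K′ + ln(k/4) → 0`; we use instead the elementary bounds `|E − K| ≤ m·√2·π/2` (`m ≤ ½`,
  `abs_Dt_le`) and `0 ≤ K′ ≤ (π/2)/√m` (`abs_Kt_one_sub_le`, since `1 − (1 − m)sin²θ ≥ m`), so
  `(E − K)K′ = O(√m)`;
* `Lawden1989_eq_3_8_29_holds` — (3.8.29) for `completeEllipticK/E`, `0 < k < 1`.

## References

* [Lawden1989] D. F. Lawden, *Elliptic Functions and Applications*, Applied Mathematical Sciences
  80, Springer (1989), §3.1 (3.1.3); §3.8, eqs. (3.8.1), (3.8.3), (3.8.7)–(3.8.12), (3.8.14),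
  (3.8.24)–(3.8.29) (PDF pp. 99–100).
-/

noncomputable section

open Real Set Filter _root_.MeasureTheory _root_.Topology

namespace Literature.Analysis.SpecialFunctions

namespace LegendreRelation

/-! ### The radicand `1 − m sin²θ` of (3.8.1), (3.8.3) -/

/-- For `m < 1` the radicand `1 − m sin²θ` of (3.8.1) is positive. [folklore] -/
theorem radicand_pos {m : ℝ} (hm : m < 1) (θ : ℝ) : 0 < 1 - m * sin θ ^ 2 := by
  rcases le_or_gt m 0 with h | h
  · nlinarith [sq_nonneg (sin θ)]
  · nlinarith [sin_sq_le_one θ]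

/-- For `m < 1`, `√(1 − m sin²θ) > 0`. [folklore] -/
theorem sqrt_radicand_pos {m : ℝ} (hm : m < 1) (θ : ℝ) : 0 < √(1 - m * sin θ ^ 2) :=
  Real.sqrt_pos.mpr (radicand_pos hm θ)

/-- Continuity of `θ ↦ √(1 − m sin²θ)`, the integrand of (3.8.3). [folklore] -/
theorem continuous_sqrt_radicand (m : ℝ) : Continuous fun θ : ℝ => √(1 - m * sin θ ^ 2) := by
  fun_prop

/-- Continuity of `θ ↦ (1 − m sin²θ)^{-1/2}`, the integrand of (3.8.1), for `m < 1`. [folklore] -/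
theorem continuous_inv_sqrt_radicand {m : ℝ} (hm : m < 1) :
    Continuous fun θ : ℝ => 1 / √(1 - m * sin θ ^ 2) :=
  continuous_const.div (continuous_sqrt_radicand m) fun θ => (sqrt_radicand_pos hm θ).ne'

/-- Continuity of the integrand `sin²θ (1 − m sin²θ)^{-3/2}` of (3.8.8), for `m < 1`. [folklore] -/
theorem continuous_Ct_integrand {m : ℝ} (hm : m < 1) :
    Continuous fun θ : ℝ => sin θ ^ 2 / ((1 - m * sin θ ^ 2) * √(1 - m * sin θ ^ 2)) :=
  (by fun_prop : Continuous fun θ : ℝ => sin θ ^ 2).div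
    ((by fun_prop : Continuous fun θ : ℝ => 1 - m * sin θ ^ 2).mul (continuous_sqrt_radicand m))
    fun θ => (mul_pos (radicand_pos hm θ) (sqrt_radicand_pos hm θ)).ne'

/-- Continuity of the integrand `cos²θ (1 − m sin²θ)^{-1/2}` of (3.8.10), for `m < 1`. [folklore] -/
theorem continuous_Gt_integrand {m : ℝ} (hm : m < 1) :
    Continuous fun θ : ℝ => cos θ ^ 2 / √(1 - m * sin θ ^ 2) :=
  (by fun_prop : Continuous fun θ : ℝ => cos θ ^ 2).div (continuous_sqrt_radicand m)
    fun θ => (sqrt_radicand_pos hm θ).ne'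

/-! ### The substitution `t = sin θ`: (3.1.3) ↔ (3.8.1), (3.8.3) -/

/-- `sin` maps `(0, π/2)` onto `(0, 1)`. [folklore] -/
theorem image_sin_Ioo : sin '' Ioo (0:ℝ) (π / 2) = Ioo 0 1 := by
  ext x
  constructor
  · rintro ⟨θ, hθ, rfl⟩
    refine ⟨sin_pos_of_pos_of_lt_pi hθ.1 (by linarith [hθ.2, pi_pos]), ?_⟩
    rw [← sin_pi_div_two]
    exact strictMonoOn_sin ⟨by linarith [hθ.1, pi_pos], hθ.2.le⟩ ⟨by linarith [pi_pos], le_rfl⟩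
      hθ.2
  · intro hx
    exact ⟨arcsin x, ⟨arcsin_pos.mpr hx.1, arcsin_lt_pi_div_two.mpr hx.2⟩,
      sin_arcsin (by linarith [hx.1]) hx.2.le⟩

/-- Change of variables `t = sin θ` on `(0,1)`: `∫_{(0,1)} g = ∫_{θ ∈ (0,π/2)} cos θ · g(sin θ)` for
every `g` (Bochner integrals; no integrability hypothesis). [folklore] -/
theorem integral_Ioo_comp_sin (g : ℝ → ℝ) :
    ∫ t in Ioo (0:ℝ) 1, g t = ∫ θ in Ioo (0:ℝ) (π / 2), cos θ * g (sin θ) := by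
  have hderiv : ∀ θ ∈ Ioo (0:ℝ) (π / 2), HasDerivWithinAt sin (cos θ) (Ioo 0 (π / 2)) θ :=
    fun θ _ => (hasDerivAt_sin θ).hasDerivWithinAt
  have hinj : InjOn sin (Ioo (0:ℝ) (π / 2)) := fun a ha b hb hab =>
    injOn_sin ⟨by linarith [ha.1, pi_pos], ha.2.le⟩ ⟨by linarith [hb.1, pi_pos], hb.2.le⟩ hab
  have key := integral_image_eq_integral_abs_deriv_smul measurableSet_Ioo hderiv hinj g
  rw [image_sin_Ioo] at key
  rw [key]
  refine setIntegral_congr_fun measurableSet_Ioo (fun θ hθ => ?_)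
  rw [smul_eq_mul, abs_of_pos (cos_pos_of_mem_Ioo ⟨by linarith [hθ.1, pi_pos], hθ.2⟩)]

/-- **Lawden (3.8.1)** (in `m = k²`): `K(k) = ∫₀^{π/2} (1 − k² sin²θ)^{-1/2} dθ`, obtained from the
algebraic form (3.1.3) by `t = sin θ`. [cite: Lawden1989, §3.8 eq. (3.8.1)] -/
theorem completeEllipticK_eq_Kt (k : ℝ) :
    completeEllipticK k = ∫ θ in (0:ℝ)..π / 2, 1 / √(1 - k ^ 2 * sin θ ^ 2) := by
  unfold completeEllipticK
  rw [integral_Ioo_comp_sin, intervalIntegral.integral_of_le (by positivity),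
    integral_Ioc_eq_integral_Ioo]
  refine setIntegral_congr_fun measurableSet_Ioo (fun θ hθ => ?_)
  show cos θ * (1 / √((1 - sin θ ^ 2) * (1 - k ^ 2 * sin θ ^ 2))) = 1 / √(1 - k ^ 2 * sin θ ^ 2)
  have hc : 0 < cos θ := cos_pos_of_mem_Ioo ⟨by linarith [hθ.1, pi_pos], hθ.2⟩
  have h1 : 1 - sin θ ^ 2 = cos θ ^ 2 := by linarith [sin_sq_add_cos_sq θ]
  rw [h1, Real.sqrt_mul (sq_nonneg _), Real.sqrt_sq hc.le, mul_one_div, div_mul_cancel_left₀ hc.ne',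
    one_div]

/-- **Lawden (3.8.3)** (in `m = k²`): `E(k) = ∫₀^{π/2} (1 − k² sin²θ)^{1/2} dθ`, obtained from the
algebraic form by `t = sin θ`. [cite: Lawden1989, §3.8 eq. (3.8.3)] -/
theorem completeEllipticE_eq_Et (k : ℝ) :
    completeEllipticE k = ∫ θ in (0:ℝ)..π / 2, √(1 - k ^ 2 * sin θ ^ 2) := by
  unfold completeEllipticE
  rw [integral_Ioo_comp_sin, intervalIntegral.integral_of_le (by positivity),
    integral_Ioc_eq_integral_Ioo]
  refine setIntegral_congr_fun measurableSet_Ioo (fun θ hθ => ?_)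
  show cos θ * (√(1 - k ^ 2 * sin θ ^ 2) / √(1 - sin θ ^ 2)) = √(1 - k ^ 2 * sin θ ^ 2)
  have hc : 0 < cos θ := cos_pos_of_mem_Ioo ⟨by linarith [hθ.1, pi_pos], hθ.2⟩
  have h1 : 1 - sin θ ^ 2 = cos θ ^ 2 := by linarith [sin_sq_add_cos_sq θ]
  rw [h1, Real.sqrt_sq hc.le]
  field_simp

/-! ### Differentiation under the integral sign: (3.8.7), (3.8.8) -/

/-- Near any `m₀ < 1` the radicand `1 − m sin²θ` is bounded below by a positive constant, uniformly
in `θ`. [folklore] -/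
theorem radicand_lower {m₀ : ℝ} (hm₀ : m₀ < 1) :
    ∃ ε > 0, ∃ c > 0, ∀ m ∈ Metric.ball m₀ ε, ∀ θ : ℝ, c ≤ 1 - m * sin θ ^ 2 := by
  refine ⟨(1 - m₀) / 2, by linarith, min ((1 - m₀) / 2) 1, lt_min (by linarith) one_pos, ?_⟩
  intro m hm θ
  rw [Metric.mem_ball, Real.dist_eq, abs_lt] at hm
  have hs0 : 0 ≤ sin θ ^ 2 := sq_nonneg _
  have hs1 : sin θ ^ 2 ≤ 1 := sin_sq_le_one θ
  rcases le_or_gt m 0 with h | h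
  · calc min ((1 - m₀) / 2) 1 ≤ 1 := min_le_right _ _
      _ ≤ 1 - m * sin θ ^ 2 := by nlinarith
  · calc min ((1 - m₀) / 2) 1 ≤ (1 - m₀) / 2 := min_le_left _ _
      _ ≤ 1 - m * sin θ ^ 2 := by nlinarith

/-- `d/dm (1 − m sin²θ)^{1/2} = −sin²θ / (2(1 − m sin²θ)^{1/2})` (pointwise step of (3.8.7)).
[folklore] -/
theorem hasDerivAt_sqrt_radicand {m : ℝ} (θ : ℝ) (h : 0 < 1 - m * sin θ ^ 2) :
    HasDerivAt (fun x : ℝ => √(1 - x * sin θ ^ 2))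
      (-(sin θ ^ 2) / (2 * √(1 - m * sin θ ^ 2))) m := by
  have h1 : HasDerivAt (fun x : ℝ => 1 - x * sin θ ^ 2) (-(sin θ ^ 2)) m := by
    simpa using ((hasDerivAt_id m).mul_const (sin θ ^ 2)).const_sub 1
  exact h1.sqrt h.ne'

/-- `d/dm (1 − m sin²θ)^{-1/2} = sin²θ / (2(1 − m sin²θ)^{3/2})` (pointwise step of (3.8.8)).
[folklore] -/
theorem hasDerivAt_inv_sqrt_radicand {m : ℝ} (θ : ℝ) (h : 0 < 1 - m * sin θ ^ 2) :
    HasDerivAt (fun x : ℝ => 1 / √(1 - x * sin θ ^ 2))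
      (sin θ ^ 2 / (2 * ((1 - m * sin θ ^ 2) * √(1 - m * sin θ ^ 2)))) m := by
  have hs : 0 < √(1 - m * sin θ ^ 2) := Real.sqrt_pos.mpr h
  have h2 := (hasDerivAt_sqrt_radicand θ h).fun_inv hs.ne'
  simp only [one_div]
  refine h2.congr_deriv ?_
  rw [Real.sq_sqrt h.le]
  field_simp

/-- **Lawden (3.8.7)**, differentiation under the integral sign, in `m = k²`: for `m < 1`,
`dE/dm = −½ ∫₀^{π/2} sin²θ (1 − m sin²θ)^{-1/2} dθ` (Lawden: `dE/dk = −k ∫₀^{π/2} sin²θ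
(1 − k² sin²θ)^{-1/2} dθ`). [cite: Lawden1989, §3.8 eq. (3.8.7)] -/
theorem hasDerivAt_Et {m : ℝ} (hm : m < 1) :
    HasDerivAt (fun x => ∫ θ in (0:ℝ)..π / 2, √(1 - x * sin θ ^ 2))
      (-(1 / 2) * ∫ θ in (0:ℝ)..π / 2, sin θ ^ 2 / √(1 - m * sin θ ^ 2)) m := by
  obtain ⟨ε, hε, c, hc, hlow⟩ := radicand_lower hm
  have hc' : 0 < c := hc
  have hsc : 0 < √c := Real.sqrt_pos.mpr hc
  have key := intervalIntegral.hasDerivAt_integral_of_dominated_loc_of_deriv_le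
    (μ := volume) (a := 0) (b := π / 2) (x₀ := m)
    (F := fun x θ => √(1 - x * sin θ ^ 2))
    (F' := fun x θ => -(sin θ ^ 2) / (2 * √(1 - x * sin θ ^ 2)))
    (bound := fun _ => 1 / (2 * √c)) (Metric.ball_mem_nhds m hε)
    (Eventually.of_forall fun x => (continuous_sqrt_radicand x).aestronglyMeasurable)
    ((continuous_sqrt_radicand m).intervalIntegrable _ _)
    ((by fun_prop : Measurable fun θ : ℝ =>
      -(sin θ ^ 2) / (2 * √(1 - m * sin θ ^ 2))).aestronglyMeasurable)
    (Eventually.of_forall fun θ _ x hx => ?_) intervalIntegrable_const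
    (Eventually.of_forall fun θ _ x hx => hasDerivAt_sqrt_radicand θ (hc'.trans_le (hlow x hx θ)))
  · have hD : ∫ θ in (0:ℝ)..π / 2, -(sin θ ^ 2) / (2 * √(1 - m * sin θ ^ 2)) =
        -(1 / 2) * ∫ θ in (0:ℝ)..π / 2, sin θ ^ 2 / √(1 - m * sin θ ^ 2) := by
      rw [← intervalIntegral.integral_const_mul]
      exact intervalIntegral.integral_congr fun θ _ => by ring
    rw [← hD]
    exact key.2
  · show ‖-(sin θ ^ 2) / (2 * √(1 - x * sin θ ^ 2))‖ ≤ 1 / (2 * √c)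
    have hu : c ≤ 1 - x * sin θ ^ 2 := hlow x hx θ
    have hsu : √c ≤ √(1 - x * sin θ ^ 2) := Real.sqrt_le_sqrt hu
    rw [Real.norm_eq_abs, abs_div, abs_neg, abs_pow, abs_mul, abs_of_pos (two_pos : (0:ℝ) < 2),
      abs_of_nonneg (Real.sqrt_nonneg _), sq_abs]
    calc sin θ ^ 2 / (2 * √(1 - x * sin θ ^ 2)) ≤ 1 / (2 * √(1 - x * sin θ ^ 2)) := by
          gcongr; exact sin_sq_le_one θ
      _ ≤ 1 / (2 * √c) := by gcongr

/-- **Lawden (3.8.8)**, differentiation under the integral sign, in `m = k²`: for `m < 1`,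
`dK/dm = ½ ∫₀^{π/2} sin²θ (1 − m sin²θ)^{-3/2} dθ` (Lawden: `dK/dk = k ∫₀^{π/2} sin²θ
(1 − k² sin²θ)^{-3/2} dθ`). [cite: Lawden1989, §3.8 eq. (3.8.8)] -/
theorem hasDerivAt_Kt {m : ℝ} (hm : m < 1) :
    HasDerivAt (fun x => ∫ θ in (0:ℝ)..π / 2, 1 / √(1 - x * sin θ ^ 2))
      (1 / 2 * ∫ θ in (0:ℝ)..π / 2,
        sin θ ^ 2 / ((1 - m * sin θ ^ 2) * √(1 - m * sin θ ^ 2))) m := by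
  obtain ⟨ε, hε, c, hc, hlow⟩ := radicand_lower hm
  have hc' : 0 < c := hc
  have hsc : 0 < √c := Real.sqrt_pos.mpr hc
  have key := intervalIntegral.hasDerivAt_integral_of_dominated_loc_of_deriv_le
    (μ := volume) (a := 0) (b := π / 2) (x₀ := m)
    (F := fun x θ => 1 / √(1 - x * sin θ ^ 2))
    (F' := fun x θ => sin θ ^ 2 / (2 * ((1 - x * sin θ ^ 2) * √(1 - x * sin θ ^ 2))))
    (bound := fun _ => 1 / (2 * (c * √c))) (Metric.ball_mem_nhds m hε)
    (Eventually.of_forall fun x =>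
      ((by fun_prop : Measurable fun θ : ℝ => 1 / √(1 - x * sin θ ^ 2))).aestronglyMeasurable)
    ((continuous_inv_sqrt_radicand hm).intervalIntegrable _ _)
    ((by fun_prop : Measurable fun θ : ℝ =>
      sin θ ^ 2 / (2 * ((1 - m * sin θ ^ 2) * √(1 - m * sin θ ^ 2)))).aestronglyMeasurable)
    (Eventually.of_forall fun θ _ x hx => ?_) intervalIntegrable_const
    (Eventually.of_forall fun θ _ x hx =>
      hasDerivAt_inv_sqrt_radicand θ (hc'.trans_le (hlow x hx θ)))
  · have hC : ∫ θ in (0:ℝ)..π / 2,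
        sin θ ^ 2 / (2 * ((1 - m * sin θ ^ 2) * √(1 - m * sin θ ^ 2))) =
          1 / 2 * ∫ θ in (0:ℝ)..π / 2,
            sin θ ^ 2 / ((1 - m * sin θ ^ 2) * √(1 - m * sin θ ^ 2)) := by
      rw [← intervalIntegral.integral_const_mul]
      refine intervalIntegral.integral_congr fun θ _ => ?_
      have h1 : 1 - m * sin θ ^ 2 ≠ 0 := (radicand_pos hm θ).ne'
      have h2 : √(1 - m * sin θ ^ 2) ≠ 0 := (sqrt_radicand_pos hm θ).ne'
      field_simp
    rw [← hC]
    exact key.2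
  · show ‖sin θ ^ 2 / (2 * ((1 - x * sin θ ^ 2) * √(1 - x * sin θ ^ 2)))‖ ≤ 1 / (2 * (c * √c))
    have hu : c ≤ 1 - x * sin θ ^ 2 := hlow x hx θ
    have hsu : √c ≤ √(1 - x * sin θ ^ 2) := Real.sqrt_le_sqrt hu
    have hupos : 0 < 1 - x * sin θ ^ 2 := hc'.trans_le hu
    have h0 : 0 ≤ sin θ ^ 2 / (2 * ((1 - x * sin θ ^ 2) * √(1 - x * sin θ ^ 2))) := by positivity
    rw [Real.norm_eq_abs, abs_of_nonneg h0]
    calc sin θ ^ 2 / (2 * ((1 - x * sin θ ^ 2) * √(1 - x * sin θ ^ 2)))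
        ≤ 1 / (2 * ((1 - x * sin θ ^ 2) * √(1 - x * sin θ ^ 2))) := by
          gcongr; exact sin_sq_le_one θ
      _ ≤ 1 / (2 * (c * √c)) := by gcongr

/-! ### Lawden's identity (3.8.9)–(3.8.10) and the relations (3.8.7), (3.8.11), (3.8.12) -/

/-- The algebra behind (3.8.9): with `S = sin θ`, `C = cos θ`, `s = √(1 − mS²)`, the `θ`-derivative
of `SC/s` delivered by the quotient rule equals `C²/s − (1 − m)S²/((1 − mS²)s)`. [folklore] -/
theorem deriv_aux (S C s m : ℝ) (hs : s ≠ 0) (hSC : S ^ 2 + C ^ 2 = 1)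
    (hu : s ^ 2 = 1 - m * S ^ 2) :
    C ^ 2 / s - (1 - m) * (S ^ 2 / ((1 - m * S ^ 2) * s)) =
      ((C * C + S * -S) * s - S * C * (-(m * (2 * S * C)) / (2 * s))) / s ^ 2 := by
  have key : C ^ 2 * s ^ 2 - (1 - m) * S ^ 2 = (C * C + S * -S) * s ^ 2 + m * S ^ 2 * C ^ 2 := by
    linear_combination S ^ 2 * hu - m * S ^ 2 * hSC
  have hL : C ^ 2 / s - (1 - m) * (S ^ 2 / ((1 - m * S ^ 2) * s)) =
      (C ^ 2 * s ^ 2 - (1 - m) * S ^ 2) / s ^ 3 := by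
    rw [← hu]
    field_simp
  have hR : ((C * C + S * -S) * s - S * C * (-(m * (2 * S * C)) / (2 * s))) / s ^ 2 =
      ((C * C + S * -S) * s ^ 2 + m * S ^ 2 * C ^ 2) / s ^ 3 := by
    field_simp
    ring
  rw [hL, hR, key]

/-- **Lawden (3.8.9)–(3.8.10)** (`k′² = 1 − m`): for `m < 1`,
`∫₀^{π/2} cos²θ (1 − m sin²θ)^{-1/2} dθ = (1 − m) ∫₀^{π/2} sin²θ (1 − m sin²θ)^{-3/2} dθ`, by
integrating `d/dθ [sin θ cos θ (1 − m sin²θ)^{-1/2}]` over `[0, π/2]` (the boundary terms vanish).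
[cite: Lawden1989, §3.8 eq. (3.8.10)] -/
theorem Gt_eq {m : ℝ} (hm : m < 1) :
    ∫ θ in (0:ℝ)..π / 2, cos θ ^ 2 / √(1 - m * sin θ ^ 2) =
      (1 - m) * ∫ θ in (0:ℝ)..π / 2,
        sin θ ^ 2 / ((1 - m * sin θ ^ 2) * √(1 - m * sin θ ^ 2)) := by
  have hu := radicand_pos hm
  have hs := sqrt_radicand_pos hm
  have hderiv : ∀ θ ∈ uIcc (0:ℝ) (π / 2),
      HasDerivAt (fun θ => sin θ * cos θ / √(1 - m * sin θ ^ 2))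
        (cos θ ^ 2 / √(1 - m * sin θ ^ 2) -
          (1 - m) * (sin θ ^ 2 / ((1 - m * sin θ ^ 2) * √(1 - m * sin θ ^ 2)))) θ := by
    intro θ _
    have h1 : HasDerivAt (fun θ => sin θ * cos θ) (cos θ * cos θ + sin θ * -sin θ) θ :=
      (hasDerivAt_sin θ).fun_mul (hasDerivAt_cos θ)
    have h2 : HasDerivAt (fun θ => 1 - m * sin θ ^ 2) (-(m * (2 * sin θ * cos θ))) θ := by
      have h := (((hasDerivAt_sin θ).fun_pow 2).const_mul m).const_sub 1
      refine h.congr_deriv ?_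
      norm_num
    have h3 := h2.sqrt (hu θ).ne'
    have h4 := h1.fun_div h3 (hs θ).ne'
    exact h4.congr_deriv
      (deriv_aux (sin θ) (cos θ) _ m (hs θ).ne' (sin_sq_add_cos_sq θ) (Real.sq_sqrt (hu θ).le)).symm
  have hint := intervalIntegral.integral_eq_sub_of_hasDerivAt hderiv
    (((continuous_Gt_integrand hm).sub
      ((continuous_Ct_integrand hm).const_mul (1 - m))).intervalIntegrable _ _)
  rw [intervalIntegral.integral_sub ((continuous_Gt_integrand hm).intervalIntegrable _ _)
      (((continuous_Ct_integrand hm).const_mul (1 - m)).intervalIntegrable _ _),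
    intervalIntegral.integral_const_mul] at hint
  simp only [sin_zero, cos_pi_div_two, zero_mul, mul_zero, zero_div, sub_zero] at hint
  linarith

/-- **Lawden (3.8.7), right-hand side** (= (3.8.15) `J = K − E`), in `m = k²`: for `m < 1`,
`E − K = −m ∫₀^{π/2} sin²θ (1 − m sin²θ)^{-1/2} dθ`. [cite: Lawden1989, §3.8 eq. (3.8.7)] -/
theorem Et_sub_Kt {m : ℝ} (hm : m < 1) :
    (∫ θ in (0:ℝ)..π / 2, √(1 - m * sin θ ^ 2)) - (∫ θ in (0:ℝ)..π / 2, 1 / √(1 - m * sin θ ^ 2)) =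
      -m * ∫ θ in (0:ℝ)..π / 2, sin θ ^ 2 / √(1 - m * sin θ ^ 2) := by
  rw [← intervalIntegral.integral_sub ((continuous_sqrt_radicand m).intervalIntegrable _ _)
      ((continuous_inv_sqrt_radicand hm).intervalIntegrable _ _),
    ← intervalIntegral.integral_const_mul]
  refine intervalIntegral.integral_congr fun θ _ => ?_
  have hu := radicand_pos hm θ
  have hs := sqrt_radicand_pos hm θ
  rw [sub_div' hs.ne', Real.mul_self_sqrt hu.le, mul_div_assoc']
  congr 1
  ring

/-- **Lawden (3.8.11)** (`k′² = 1 − m`): for `m < 1`,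
`E − (1 − m)K = m ∫₀^{π/2} cos²θ (1 − m sin²θ)^{-1/2} dθ`. [cite: Lawden1989, §3.8 eq. (3.8.11)] -/
theorem Et_sub_mul_Kt {m : ℝ} (hm : m < 1) :
    (∫ θ in (0:ℝ)..π / 2, √(1 - m * sin θ ^ 2)) -
        (1 - m) * (∫ θ in (0:ℝ)..π / 2, 1 / √(1 - m * sin θ ^ 2)) =
      m * ∫ θ in (0:ℝ)..π / 2, cos θ ^ 2 / √(1 - m * sin θ ^ 2) := by
  rw [← intervalIntegral.integral_const_mul, ← intervalIntegral.integral_const_mul,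
    ← intervalIntegral.integral_sub ((continuous_sqrt_radicand m).intervalIntegrable _ _)
      (((continuous_inv_sqrt_radicand hm).const_mul (1 - m)).intervalIntegrable _ _)]
  refine intervalIntegral.integral_congr fun θ _ => ?_
  have hu := radicand_pos hm θ
  have hs := sqrt_radicand_pos hm θ
  rw [mul_one_div, sub_div' hs.ne', Real.mul_self_sqrt hu.le, mul_div_assoc']
  congr 1
  linear_combination (-m) * sin_sq_add_cos_sq θ

/-- **Lawden (3.8.12)** in parameter form: for `m < 1`,
`m(1 − m) ∫₀^{π/2} sin²θ (1 − m sin²θ)^{-3/2} dθ = E − (1 − m)K`, i.e. with (3.8.8)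
`dK/dm = (E − (1 − m)K)/(2m(1 − m))` (Lawden: `dK/dk = (E − k′²K)/(kk′²)`; from (3.8.10), (3.8.11)).
[cite: Lawden1989, §3.8 eq. (3.8.12)] -/
theorem Ct_relation {m : ℝ} (hm : m < 1) :
    m * (1 - m) * (∫ θ in (0:ℝ)..π / 2,
        sin θ ^ 2 / ((1 - m * sin θ ^ 2) * √(1 - m * sin θ ^ 2))) =
      (∫ θ in (0:ℝ)..π / 2, √(1 - m * sin θ ^ 2)) -
        (1 - m) * ∫ θ in (0:ℝ)..π / 2, 1 / √(1 - m * sin θ ^ 2) := by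
  rw [Et_sub_mul_Kt hm, Gt_eq hm]
  ring

/-! ### (3.8.25)–(3.8.27): the values and bounds entering the limit `m → 0⁺` -/

/-- `m ↦ E` ((3.8.3)) is continuous on `ℝ` (joint continuity of `√(1 − m sin²θ)`). [folklore] -/
theorem continuous_Et : Continuous fun x : ℝ => ∫ θ in (0:ℝ)..π / 2, √(1 - x * sin θ ^ 2) := by
  have h : Continuous (Function.uncurry fun (x θ : ℝ) => √(1 - x * sin θ ^ 2)) := by
    show Continuous fun p : ℝ × ℝ => √(1 - p.1 * sin p.2 ^ 2)
    fun_prop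
  exact intervalIntegral.continuous_parametric_intervalIntegral_of_continuous' h 0 (π / 2)

/-- **Lawden (3.8.25)**, `lim_{k→0} E′ = 1`: at `m = 1`, `E = ∫₀^{π/2} cos θ dθ = 1`, and `m ↦ E` is
continuous there. [cite: Lawden1989, §3.8 eq. (3.8.25)] -/
theorem tendsto_Et_one :
    Tendsto (fun x : ℝ => ∫ θ in (0:ℝ)..π / 2, √(1 - x * sin θ ^ 2)) (𝓝 1) (𝓝 1) := by
  have h1 : (∫ θ in (0:ℝ)..π / 2, √(1 - 1 * sin θ ^ 2)) = 1 := by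
    have : (∫ θ in (0:ℝ)..π / 2, √(1 - 1 * sin θ ^ 2)) = ∫ θ in (0:ℝ)..π / 2, cos θ := by
      refine intervalIntegral.integral_congr fun θ hθ => ?_
      rw [uIcc_of_le (by positivity)] at hθ
      have hc : 0 ≤ cos θ := cos_nonneg_of_mem_Icc ⟨by linarith [hθ.1, pi_pos], hθ.2⟩
      rw [one_mul, show 1 - sin θ ^ 2 = cos θ ^ 2 by linarith [sin_sq_add_cos_sq θ],
        Real.sqrt_sq hc]
    rw [this, integral_cos, sin_pi_div_two, sin_zero, sub_zero]
  have h := continuous_Et.tendsto 1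
  rw [h1] at h
  exact h

/-- **Lawden (3.8.25)**, `lim_{k→0} K = π/2`: at `m = 0`, `K = ∫₀^{π/2} dθ = π/2`.
[cite: Lawden1989, §3.8 eq. (3.8.25)] -/
theorem Kt_zero : (∫ θ in (0:ℝ)..π / 2, 1 / √(1 - 0 * sin θ ^ 2)) = π / 2 := by
  simp

/-- (3.8.27), first factor ("`(E − K)` is `O(k²)` for small `k`"): for `m ≤ 1/2`,
`|∫₀^{π/2} sin²θ (1 − m sin²θ)^{-1/2} dθ| ≤ √2·π/2`. [cite: Lawden1989, §3.8 eq. (3.8.27)] -/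
theorem abs_Dt_le {m : ℝ} (hm : m ≤ 1 / 2) :
    |∫ θ in (0:ℝ)..π / 2, sin θ ^ 2 / √(1 - m * sin θ ^ 2)| ≤ √2 * (π / 2) := by
  have h := intervalIntegral.norm_integral_le_of_norm_le_const (a := (0:ℝ)) (b := π / 2)
    (C := √2) (f := fun θ => sin θ ^ 2 / √(1 - m * sin θ ^ 2)) ?_
  · rw [Real.norm_eq_abs] at h
    calc _ ≤ √2 * |π / 2 - 0| := h
      _ = √2 * (π / 2) := by rw [sub_zero, abs_of_pos (by positivity)]
  · intro θ _
    have hu : 1 / 2 ≤ 1 - m * sin θ ^ 2 := by nlinarith [sin_sq_le_one θ, sq_nonneg (sin θ)]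
    have hupos : 0 < 1 - m * sin θ ^ 2 := by linarith
    have h1 : 1 ≤ √(2 * (1 - m * sin θ ^ 2)) := Real.one_le_sqrt.mpr (by linarith)
    rw [Real.sqrt_mul (by norm_num : (0:ℝ) ≤ 2)] at h1
    rw [Real.norm_eq_abs, abs_of_nonneg (div_nonneg (sq_nonneg _) (Real.sqrt_nonneg _)),
      div_le_iff₀ (Real.sqrt_pos.mpr hupos)]
    linarith [sin_sq_le_one θ]

/-- (3.8.27), second factor (elementary replacement of Lawden's nome asymptotics (3.8.26)): for
`0 < m ≤ 1`, `|K′| = |∫₀^{π/2} (1 − (1 − m) sin²θ)^{-1/2} dθ| ≤ (π/2)/√m`, since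
`1 − (1 − m) sin²θ ≥ m`. [cite: Lawden1989, §3.8 eq. (3.8.27)] -/
theorem abs_Kt_one_sub_le {m : ℝ} (hm0 : 0 < m) (hm1 : m ≤ 1) :
    |∫ θ in (0:ℝ)..π / 2, 1 / √(1 - (1 - m) * sin θ ^ 2)| ≤ π / 2 / √m := by
  have hsm : 0 < √m := Real.sqrt_pos.mpr hm0
  have h := intervalIntegral.norm_integral_le_of_norm_le_const (a := (0:ℝ)) (b := π / 2)
    (C := 1 / √m) (f := fun θ => 1 / √(1 - (1 - m) * sin θ ^ 2)) ?_
  · rw [Real.norm_eq_abs] at h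
    calc _ ≤ 1 / √m * |π / 2 - 0| := h
      _ = π / 2 / √m := by rw [sub_zero, abs_of_pos (by positivity)]; ring
  · intro θ _
    have hu : m ≤ 1 - (1 - m) * sin θ ^ 2 := by nlinarith [sin_sq_le_one θ, sq_nonneg (sin θ)]
    have hsu : √m ≤ √(1 - (1 - m) * sin θ ^ 2) := Real.sqrt_le_sqrt hu
    rw [Real.norm_eq_abs, abs_of_nonneg (by positivity)]
    gcongr

/-! ### The abstract Legendre argument: (3.8.24) and the limit (3.8.28) ⇒ (3.8.29) -/

section Abstract

variable {K E D C : ℝ → ℝ}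

/-- **Lawden (3.8.24)**, abstract form: if on `m < 1` one has `dK/dm = C/2`, `dE/dm = −D/2`,
`E − K = −mD` ((3.8.7)) and `m(1 − m)C = E − (1 − m)K` ((3.8.12)), then
`d/dm [E(m)K(1 − m) + E(1 − m)K(m) − K(m)K(1 − m)] = 0` for `0 < m < 1` (the primed functions of
(3.8.14) are `m ↦ K(1 − m)`, `m ↦ E(1 − m)`). [cite: Lawden1989, §3.8 eq. (3.8.24)] -/
theorem hasDerivAt_legendre (hK : ∀ m : ℝ, m < 1 → HasDerivAt K (1 / 2 * C m) m)
    (hE : ∀ m : ℝ, m < 1 → HasDerivAt E (-(1 / 2) * D m) m)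
    (r1 : ∀ m : ℝ, m < 1 → E m - K m = -m * D m)
    (r2 : ∀ m : ℝ, m < 1 → m * (1 - m) * C m = E m - (1 - m) * K m)
    {m : ℝ} (hm0 : 0 < m) (hm1 : m < 1) :
    HasDerivAt (fun x => E x * K (1 - x) + E (1 - x) * K x - K x * K (1 - x)) 0 m := by
  have hm' : 1 - m < 1 := by linarith
  have hsub : HasDerivAt (fun x : ℝ => 1 - x) (-1) m := by
    simpa using (hasDerivAt_id m).const_sub 1
  have hE' : HasDerivAt (fun x => E (1 - x)) (-(1 / 2) * D (1 - m) * -1) m :=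
    (hE _ hm').comp m hsub
  have hK' : HasDerivAt (fun x => K (1 - x)) (1 / 2 * C (1 - m) * -1) m :=
    (hK _ hm').comp m hsub
  have h := (((hE _ hm1).fun_mul hK').fun_add (hE'.fun_mul (hK _ hm1))).fun_sub
    ((hK _ hm1).fun_mul hK')
  refine h.congr_deriv ?_
  have r1a := r1 _ hm1
  have r2a := r2 _ hm1
  have r1b := r1 _ hm'
  have r2b := r2 _ hm'
  have hmm : m * (1 - m) ≠ 0 := (mul_pos hm0 (by linarith)).ne'
  have key : m * (1 - m) *
      (-(1 / 2) * D m * K (1 - m) + E m * (1 / 2 * C (1 - m) * -1) +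
        (-(1 / 2) * D (1 - m) * -1 * K m + E (1 - m) * (1 / 2 * C m)) -
      (1 / 2 * C m * K (1 - m) + K m * (1 / 2 * C (1 - m) * -1))) = 0 := by
    linear_combination (-(1 / 2) * ((1 - m) * K (1 - m))) * r1a
      + (1 / 2 * (E (1 - m) - K (1 - m))) * r2a + (1 / 2 * (m * K m)) * r1b
      + (1 / 2 * (K m - E m)) * r2b
  rcases mul_eq_zero.mp key with h0 | h0
  · exact absurd h0 hmm
  · exact h0

/-- The integrated form of (3.8.24): under the hypotheses of `hasDerivAt_legendre`,
`E(m)K(1 − m) + E(1 − m)K(m) − K(m)K(1 − m)` takes the same value at any two points of `(0,1)`.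
[cite: Lawden1989, §3.8 eq. (3.8.24)] -/
theorem legendre_eq_legendre (hK : ∀ m : ℝ, m < 1 → HasDerivAt K (1 / 2 * C m) m)
    (hE : ∀ m : ℝ, m < 1 → HasDerivAt E (-(1 / 2) * D m) m)
    (r1 : ∀ m : ℝ, m < 1 → E m - K m = -m * D m)
    (r2 : ∀ m : ℝ, m < 1 → m * (1 - m) * C m = E m - (1 - m) * K m)
    {x y : ℝ} (hx : x ∈ Ioo (0:ℝ) 1) (hy : y ∈ Ioo (0:ℝ) 1) :
    E x * K (1 - x) + E (1 - x) * K x - K x * K (1 - x) =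
      E y * K (1 - y) + E (1 - y) * K y - K y * K (1 - y) := by
  wlog hxy : x ≤ y generalizing x y
  · exact (this hy hx (le_of_not_ge hxy)).symm
  have hd : ∀ t ∈ Icc x y,
      HasDerivAt (fun x => E x * K (1 - x) + E (1 - x) * K x - K x * K (1 - x)) 0 t :=
    fun t ht => hasDerivAt_legendre hK hE r1 r2 (by linarith [hx.1, ht.1]) (by linarith [hy.2, ht.2])
  exact (constant_of_has_deriv_right_zero
    (f := fun x => E x * K (1 - x) + E (1 - x) * K x - K x * K (1 - x))
    (fun t ht => (hd t ht).continuousAt.continuousWithinAt)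
    (fun t ht => (hd t (Ico_subset_Icc_self ht)).hasDerivWithinAt) y ⟨hxy, le_rfl⟩).symm

/-- **Lawden (3.8.25)–(3.8.28)**, abstract form of the limit: if `K` is differentiable at `0` with
`K(0) = π/2`, `E → 1` at `1`, `E − K = −mD` with `D` bounded on `(0, ½]`, and `|K(1 − m)| ≤ B/√m`
on `(0,1]`, then `E(m)K(1 − m) + E(1 − m)K(m) − K(m)K(1 − m) → π/2` as `m → 0⁺`
(`(E − K)K′ → 0`, `E′K → 1·π/2`). [cite: Lawden1989, §3.8 eq. (3.8.28)] -/
theorem tendsto_legendre {A B : ℝ} (hK : ∀ m : ℝ, m < 1 → HasDerivAt K (1 / 2 * C m) m)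
    (r1 : ∀ m : ℝ, m < 1 → E m - K m = -m * D m) (hK0 : K 0 = π / 2)
    (hE1 : Tendsto E (𝓝 1) (𝓝 1)) (hD : ∀ m : ℝ, 0 < m → m ≤ 1 / 2 → |D m| ≤ A)
    (hKb : ∀ m : ℝ, 0 < m → m ≤ 1 → |K (1 - m)| ≤ B / √m) :
    Tendsto (fun m => E m * K (1 - m) + E (1 - m) * K m - K m * K (1 - m)) (𝓝[>] 0)
      (𝓝 (π / 2)) := by
  have h1 : Tendsto (fun m => (E m - K m) * K (1 - m)) (𝓝[>] 0) (𝓝 0) := by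
    refine squeeze_zero_norm' (a := fun m => A * B * √m) ?_ ?_
    · filter_upwards [Ioo_mem_nhdsGT (by norm_num : (0:ℝ) < 1 / 2)] with m hm
      have hm0 : 0 < m := hm.1
      have hA : 0 ≤ A := (abs_nonneg _).trans (hD m hm0 hm.2.le)
      rw [norm_mul, Real.norm_eq_abs, Real.norm_eq_abs, r1 m (by linarith [hm.2]), abs_mul,
        abs_neg, abs_of_pos hm0]
      calc m * |D m| * |K (1 - m)| ≤ m * A * (B / √m) := by
            gcongr
            · exact hD m hm0 hm.2.le
            · exact hKb m hm0 (by linarith [hm.2])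
        _ = A * B * (m / √m) := by ring
        _ = A * B * √m := by rw [Real.div_sqrt]
    · have hc : Continuous fun m : ℝ => A * B * √m := Real.continuous_sqrt.const_mul _
      have := hc.tendsto 0
      rw [Real.sqrt_zero, mul_zero] at this
      exact tendsto_nhdsWithin_of_tendsto_nhds this
  have h2 : Tendsto (fun m => E (1 - m) * K m) (𝓝[>] 0) (𝓝 (1 * (π / 2))) := by
    refine Tendsto.mul ?_ ?_
    · have hc : Tendsto (fun m : ℝ => 1 - m) (𝓝 0) (𝓝 1) :=
        (continuous_const.sub continuous_id).tendsto' 0 1 (by simp)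
      have hc' : Tendsto (fun m : ℝ => E (1 - m)) (𝓝 0) (𝓝 1) := hE1.comp hc
      exact tendsto_nhdsWithin_of_tendsto_nhds hc'
    · have := (hK 0 (by norm_num)).continuousAt.tendsto
      rw [hK0] at this
      exact tendsto_nhdsWithin_of_tendsto_nhds this
  have h3 := h1.add h2
  rw [zero_add, one_mul] at h3
  exact h3.congr fun m => by ring

/-- **Lawden (3.8.29)**, abstract form: under the hypotheses of `hasDerivAt_legendre` and
`tendsto_legendre`, `E(m)K(1 − m) + E(1 − m)K(m) − K(m)K(1 − m) = π/2` for every `0 < m < 1` (the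
constant of (3.8.24) is identified by the limit (3.8.28)). [cite: Lawden1989, §3.8 eq. (3.8.29)] -/
theorem legendre_eq {A B : ℝ} (hK : ∀ m : ℝ, m < 1 → HasDerivAt K (1 / 2 * C m) m)
    (hE : ∀ m : ℝ, m < 1 → HasDerivAt E (-(1 / 2) * D m) m)
    (r1 : ∀ m : ℝ, m < 1 → E m - K m = -m * D m)
    (r2 : ∀ m : ℝ, m < 1 → m * (1 - m) * C m = E m - (1 - m) * K m)
    (hK0 : K 0 = π / 2) (hE1 : Tendsto E (𝓝 1) (𝓝 1))
    (hD : ∀ m : ℝ, 0 < m → m ≤ 1 / 2 → |D m| ≤ A)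
    (hKb : ∀ m : ℝ, 0 < m → m ≤ 1 → |K (1 - m)| ≤ B / √m)
    {m : ℝ} (hm0 : 0 < m) (hm1 : m < 1) :
    E m * K (1 - m) + E (1 - m) * K m - K m * K (1 - m) = π / 2 := by
  have hconst : (fun x => E x * K (1 - x) + E (1 - x) * K x - K x * K (1 - x)) =ᶠ[𝓝[>] 0]
      fun _ => E m * K (1 - m) + E (1 - m) * K m - K m * K (1 - m) := by
    filter_upwards [Ioo_mem_nhdsGT (zero_lt_one : (0:ℝ) < 1)] with x hx
    exact legendre_eq_legendre hK hE r1 r2 hx ⟨hm0, hm1⟩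
  exact tendsto_nhds_unique tendsto_const_nhds
    ((tendsto_legendre hK r1 hK0 hE1 hD hKb).congr' hconst)

end Abstract

end LegendreRelation

open LegendreRelation in
/-- **Legendre's relation** (Lawden 1989, (3.8.29)): for every modulus `0 < k < 1`, with
`k′ = √(1 − k²)`, `E(k)K(k′) + E(k′)K(k) − K(k)K(k′) = π/2` — DISCHARGE of the named fact
`Lawden1989_eq_3_8_29`, following Lawden's printed proof ((3.8.1)–(3.8.12), (3.8.24): the
derivative in the modulus vanishes; (3.8.25)–(3.8.28): the limit `k → 0`), in the parameter
`m = k²`. [cite: Lawden1989, §3.8 eq. (3.8.29)] -/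
theorem Lawden1989_eq_3_8_29_holds : Lawden1989_eq_3_8_29 := by
  intro k hk0 hk1
  have hm0 : 0 < k ^ 2 := by positivity
  have hm1 : k ^ 2 < 1 := by nlinarith
  have hk' : Real.sqrt (1 - k ^ 2) ^ 2 = 1 - k ^ 2 := Real.sq_sqrt (by linarith)
  simp only [completeEllipticK_eq_Kt, completeEllipticE_eq_Et, hk']
  exact legendre_eq
    (K := fun x => ∫ θ in (0:ℝ)..π / 2, 1 / √(1 - x * sin θ ^ 2))
    (E := fun x => ∫ θ in (0:ℝ)..π / 2, √(1 - x * sin θ ^ 2))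
    (D := fun x => ∫ θ in (0:ℝ)..π / 2, sin θ ^ 2 / √(1 - x * sin θ ^ 2))
    (C := fun x => ∫ θ in (0:ℝ)..π / 2, sin θ ^ 2 / ((1 - x * sin θ ^ 2) * √(1 - x * sin θ ^ 2)))
    (fun m hm => hasDerivAt_Kt hm) (fun m hm => hasDerivAt_Et hm) (fun m hm => Et_sub_Kt hm)
    (fun m hm => Ct_relation hm) Kt_zero tendsto_Et_one (fun m _ hm => abs_Dt_le hm)
    (fun m hm0 hm1 => abs_Kt_one_sub_le hm0 hm1) hm0 hm1

end Literature.Analysis.SpecialFunctions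

end
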